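import Mathlib
import Literature.AlgebraicGeometry.Resolution.CobordantGame
import Literature.AlgebraicGeometry.Resolution.CobordantChartCoefficients
import Literature.AlgebraicGeometry.Resolution.FormalCoordinateChange
import Summits.ResolutionOfSingularities.ResolutionOfSingularities.Theorems.WeightedInvariantLocalWeightedDropWildMonicTerminalPoint

/-!
# `WeightedInvariant.LocalWeightedDrop`, line `hasse-ridge-face-selection`: S3ρT — the TERMINAL CLASSES of GENERAL monic surface
# forms `y^d + Σ_{j<d} A_j(x₁,x₂) y^j` ARE WON (monomial type and small-residual type)

Crux item stmt-ResolutionOfSingularities-8899 `LocalWeightedDrop` (route `ResolutionOfSingularities/WeightedInvariant`), engine of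
the door `HypersurfaceCentreConstruction` stmt-ResolutionOfSingularities-19897.  [OURS · L1 W4.3, chain w43, res-type-083 (extra
seat S3ρ, CHAIN v4.3 D12): §1 (T) of `L/res-type-083/S3RHO-DESIGN.md` = the candidate sub-stub S3ρT `stub_wildMonicTerminalWon` of
the evidence file `StubWildMonicDescent.lean` (line under the stub S3ρ `stub_wildMonicSurfaceReductionWon` of skeleton v28), with
its terminal predicate `WildMonic.Terminal` INLINED.  Not a statement of any manuscript; the mathematics is Perlega 2017/2020 §7.3
(monomial type / small residual type of the coefficient ideal, arXiv:2011.14443) = Hironaka's one-vertex characteristic polyhedron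
with a non-solvable vertex, run as a positional strategy of the local weighted resolution game — the tuple version of stub-1's
S3πT `stub_wildPurelyInseparableTerminalWon` (p482800).]

* `termMono_won`: the MONOMIAL class (scaled vertex `(a,b)/N`, attained, non-solvable when integral) is won, by induction on
  `a + b`: curve steps while `a ≥ N` or `b ≥ N` (`termMono_curveStep₀/₁`), then the point step (`termMono_pointStep`); every
  singular successor is in the class with smaller `a + b` or exits (order `< d`; order `d` and not wide, `not_wide_of_vertex_one`).
* `terminalWon`: S3ρT — monomial type (`termMono_won`) or small-residual type (`termSR_won`).
What S3ρ still owes after this file is exactly the descent datum S3ρD (`stub_wildMonicSurfaceDescent`).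
-/

set_option linter.dupNamespace false -- mandated namespace of this single-conjunct summit

namespace Summit.ResolutionOfSingularities.ResolutionOfSingularities.Theorems

open Literature.AlgebraicGeometry.Resolution
open Literature.AlgebraicGeometry.Resolution.CobordantGame

namespace WildMonic

open MvPowerSeries

/-- THE MONOMIAL TERMINAL CLASS IS WON (every `N ≥ 1`; induction on `a + b`). -/
theorem termMono_won (p : ℕ) (hp : p.Prime) (k : Type) [Field k] [CharP k p] [IsAlgClosed k] {d : ℕ} (hd : 0 < d)
    (hord : ∀ g : MvPowerSeries (Fin 3) k, CobordantGame.IsSingular k g → g.order < d → CobordantGame.Won k 3 g)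
    (haxis : ∀ g : MvPowerSeries (Fin 3) k, CobordantGame.IsSingular k g → g.order = d →
      (∃ c : Fin 3 → k, c ≠ 0 ∧ ∀ v : Fin 3 → k,
        CobordantChart.initEval (fun _ : Fin 3 => 1) (v + c) d g = CobordantChart.initEval (fun _ : Fin 3 => 1) v d g) →
      (∀ c₁ c₂ : Fin 3 → k,
        (∀ v : Fin 3 → k, CobordantChart.initEval (fun _ : Fin 3 => 1) (v + c₁) d g =
          CobordantChart.initEval (fun _ : Fin 3 => 1) v d g) →
        (∀ v : Fin 3 → k, CobordantChart.initEval (fun _ : Fin 3 => 1) (v + c₂) d g =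
          CobordantChart.initEval (fun _ : Fin 3 => 1) v d g) →
        ∃ α β : k, (α ≠ 0 ∨ β ≠ 0) ∧ α • c₁ + β • c₂ = 0) →
      CobordantGame.Won k 3 g)
    (N : ℕ) (hN : 0 < N) :
    ∀ (r a b : ℕ), a + b = r → ∀ A : Fin d → MvPowerSeries (Fin 2) k,
      (∀ j : Fin d, ((d - (j : ℕ) : ℕ) : ℕ∞) < (A j).order) →
      (∀ (j : Fin d) (β : Fin 2 →₀ ℕ), coeff β (A j) ≠ 0 → (d - (j : ℕ)) * a ≤ N * β 0 ∧ (d - (j : ℕ)) * b ≤ N * β 1) →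
      (∃ (j₀ : Fin d) (β : Fin 2 →₀ ℕ), N * β 0 = (d - (j₀ : ℕ)) * a ∧ N * β 1 = (d - (j₀ : ℕ)) * b ∧ coeff β (A j₀) ≠ 0) →
      (N ∣ a → N ∣ b → ∀ μ : k, ∃ j : Fin d,
        coeff (Finsupp.single 0 ((d - (j : ℕ)) * a / N) + Finsupp.single 1 ((d - (j : ℕ)) * b / N)) (A j) ≠
          (d.choose (j : ℕ) : k) * (-μ) ^ (d - (j : ℕ))) →
      CobordantGame.Won k (2 + 1) ((X (Fin.last 2) : MvPowerSeries (Fin (2 + 1)) k) ^ d +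
        ∑ j : Fin d, rename (Fin.succAboveEmb (Fin.last 2)) (A j) * X (Fin.last 2) ^ (j : ℕ)) := by
  intro r
  induction r using Nat.strong_induction_on with
  | _ r ih =>
  intro a b hr A hA hM1 hM2 hM3
  have IH : ∀ a' b' : ℕ, a' + b' < r → ∀ A' : Fin d → MvPowerSeries (Fin 2) k,
      (∀ j : Fin d, ((d - (j : ℕ) : ℕ) : ℕ∞) < (A' j).order) →
      (∀ (j : Fin d) (β : Fin 2 →₀ ℕ), coeff β (A' j) ≠ 0 → (d - (j : ℕ)) * a' ≤ N * β 0 ∧ (d - (j : ℕ)) * b' ≤ N * β 1) →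
      (∃ (j₀ : Fin d) (β : Fin 2 →₀ ℕ), N * β 0 = (d - (j₀ : ℕ)) * a' ∧ N * β 1 = (d - (j₀ : ℕ)) * b' ∧ coeff β (A' j₀) ≠ 0) →
      (N ∣ a' → N ∣ b' → ∀ μ : k, ∃ j : Fin d,
        coeff (Finsupp.single 0 ((d - (j : ℕ)) * a' / N) + Finsupp.single 1 ((d - (j : ℕ)) * b' / N)) (A' j) ≠
          (d.choose (j : ℕ) : k) * (-μ) ^ (d - (j : ℕ))) →
      CobordantGame.Won k (2 + 1) ((X (Fin.last 2) : MvPowerSeries (Fin (2 + 1)) k) ^ d +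
        ∑ j : Fin d, rename (Fin.succAboveEmb (Fin.last 2)) (A' j) * X (Fin.last 2) ^ (j : ℕ)) :=
    fun a' b' h A' h1 h2 h3 h4 => ih (a' + b') h a' b' rfl A' h1 h2 h3 h4
  by_cases ha : N ≤ a
  · obtain ⟨a', rfl⟩ := Nat.exists_eq_add_of_le ha
    exact termMono_curveStep₀ p hp k hd hord haxis N hN r IH a' b hr A hA hM1 hM2 hM3
  by_cases hb : N ≤ b
  · obtain ⟨b', rfl⟩ := Nat.exists_eq_add_of_le hb
    exact termMono_curveStep₁ p hp k hd hord haxis N hN r IH a b' hr A hA hM1 hM2 hM3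
  exact termMono_pointStep p hp k hd hord haxis N hN r IH a b (not_le.mp ha) (not_le.mp hb) hr A hA hM1 hM2 hM3

/-- **S3ρT — THE TERMINAL MONIC SURFACE FORMS ARE WON** (candidate sub-stub `stub_wildMonicTerminalWon` of the S3ρ line, with
the terminal predicate `WildMonic.Terminal` of the evidence file inlined): over an algebraically closed field of characteristic `p`,
`p ∣ d > 2`, given that the singular surface germs of order `< d` and the order-`d` germs with apex of dimension exactly one are won,
every position `y^d + Σ_{j<d} A_j y^j` of MONOMIAL type (one scaled vertex `(a,b)/N`, attained, with a non-solvable vertex polynomial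
when integral) or of SMALL-RESIDUAL type (`A_j = x_i^{(d-j)m} g_j`, `m ≥ 1`, `g_j(0) = 0`, some `ord g_j < d - j`) is won.
[OURS · L1 W4.3; Perlega 2017/2020 §7.3 on the coefficient tuple.] -/
theorem terminalWon : ∀ (p : ℕ), p.Prime → ∀ (k : Type) [Field k] [CharP k p] [IsAlgClosed k],
      ∀ (d : ℕ), p ∣ d → 2 < d →
      (∀ g : MvPowerSeries (Fin 3) k, CobordantGame.IsSingular k g → g.order < d →
        CobordantGame.Won k 3 g) →
      (∀ g : MvPowerSeries (Fin 3) k, CobordantGame.IsSingular k g → g.order = d →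
        (∃ c : Fin 3 → k, c ≠ 0 ∧ ∀ v : Fin 3 → k,
          CobordantChart.initEval (fun _ : Fin 3 => 1) (v + c) d g =
            CobordantChart.initEval (fun _ : Fin 3 => 1) v d g) →
        (∀ c₁ c₂ : Fin 3 → k,
          (∀ v : Fin 3 → k, CobordantChart.initEval (fun _ : Fin 3 => 1) (v + c₁) d g =
            CobordantChart.initEval (fun _ : Fin 3 => 1) v d g) →
          (∀ v : Fin 3 → k, CobordantChart.initEval (fun _ : Fin 3 => 1) (v + c₂) d g =
            CobordantChart.initEval (fun _ : Fin 3 => 1) v d g) →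
          ∃ α β : k, (α ≠ 0 ∨ β ≠ 0) ∧ α • c₁ + β • c₂ = 0) →
        CobordantGame.Won k 3 g) →
      ∀ A : Fin d → MvPowerSeries (Fin 2) k, (∀ j : Fin d, ((d - (j : ℕ) : ℕ) : ℕ∞) < (A j).order) →
        ((∃ (N a b : ℕ), 0 < N ∧
          (∀ (j : Fin d) (β : Fin 2 →₀ ℕ), coeff β (A j) ≠ 0 → (d - (j : ℕ)) * a ≤ N * β 0 ∧ (d - (j : ℕ)) * b ≤ N * β 1) ∧
          (∃ (j₀ : Fin d) (β : Fin 2 →₀ ℕ), N * β 0 = (d - (j₀ : ℕ)) * a ∧ N * β 1 = (d - (j₀ : ℕ)) * b ∧ coeff β (A j₀) ≠ 0) ∧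
          (N ∣ a → N ∣ b → ∀ μ : k, ∃ j : Fin d,
            coeff (Finsupp.single 0 ((d - (j : ℕ)) * a / N) + Finsupp.single 1 ((d - (j : ℕ)) * b / N)) (A j) ≠
              (d.choose (j : ℕ) : k) * (-μ) ^ (d - (j : ℕ)))) ∨
        (∃ (i : Fin 2) (m : ℕ), 0 < m ∧
          (∀ j : Fin d, ∃ g : MvPowerSeries (Fin 2) k, constantCoeff g = 0 ∧ A j = X i ^ ((d - (j : ℕ)) * m) * g) ∧
          (∃ (j₁ : Fin d) (g : MvPowerSeries (Fin 2) k), A j₁ = X i ^ ((d - (j₁ : ℕ)) * m) * g ∧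
            g.order < ((d - (j₁ : ℕ) : ℕ) : ℕ∞)))) →
        CobordantGame.Won k 3 (MvPowerSeries.X (Fin.last 2) ^ d +
          ∑ j : Fin d, MvPowerSeries.rename (Fin.succAboveEmb (Fin.last 2)) (A j) * MvPowerSeries.X (Fin.last 2) ^ (j : ℕ)) := by
  intro p hp k _ _ _ d _ h2d hord haxis A hA hT
  have hd : 0 < d := by omega
  rcases hT with ⟨N, a, b, hN, hM1, hM2, hM3⟩ | ⟨i, m, hm, hdiv, hres⟩
  · exact termMono_won p hp k hd hord haxis N hN (a + b) a b rfl A hA hM1 hM2 hM3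
  · exact termSR_won p hp k hd hord m hm i A hA hdiv hres

end WildMonic

end Summit.ResolutionOfSingularities.ResolutionOfSingularities.Theorems
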